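import Summits.AnomalousDissipation.AnomalousDissipation.Theorems.BaireTransferDenseLoudDesignerForcesErgodicLine
import Literature.Analysis.FunctionSpaces.TorusLinearisedNSExistence

/-!
# Existence of the linearised flow along a classical trajectory (line `ergodic-budget-selection-closing`,
# crux `BaireTransfer.DenseLoudDesignerForces`, stmt-AnomalousDissipation-1143) — tools stub of block N

Sorry-free file over the landed vocabulary `…ErgodicLine.lean` (`IsLinearizedNSSolutionOn S ν u w q`: the
linearised Navier–Stokes equation `∂ₜw + (u·∇)w + (w·∇)u = νΔw − ∇q`, `div w = 0`, `∫ w = 0`, jointly smooth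
`w`, `q`, stated classically with the one-sided time derivative within `S`) and the landed existence theorem
for that equation on the flat torus (`Literature/Analysis/FunctionSpaces/TorusLinearisedNSExistence.lean`:
`Torus.linearisedNS_exists`, the Fourier–Picard construction `Literature/Analysis/FluidPDE/LinearisedNSFourier*`).
Block N of the line needs the DERIVATIVE COCYCLE of the NS_ν semiflow along the trajectories of an NS phase,
i.e. solutions of the linearised system along a classical solution `u` from arbitrary smooth admissible data;
this file supplies exactly that:

* `stub_linearisedExistenceTools` (the REGISTERED tools stub, proved) — for `ν > 0`, `a < b`, `u` jointly
  smooth on `[a, b] × T³` with divergence-free slices, and a smooth divergence-free mean-zero datum `w₀`,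
  there are `w`, `q` with `IsLinearizedNSSolutionOn (Icc a b) ν u w q` and `w a = w₀` (the case `d = Fin 3`
  of `Torus.linearisedNS_exists`; uniqueness is the landed `Torus.linearisedNS_unique`).

References: P. Constantin, C. Foias, *Navier–Stokes Equations* (Univ. Chicago Press 1988), Ch. 14,
(14.2)–(14.6) (the linearised equation along `S(t)u₀` and its solution operator); R. Temam,
*Infinite-Dimensional Dynamical Systems in Mechanics and Physics*, 2nd ed. (1997), Ch. VI §3.1, (3.7)–(3.11).
Nothing is asserted; no definition is added.
-/

-- `Summit.<Summit>.<Problem>` is the tree's mandated summit-side namespace (CONVENTIONS §2); for this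
-- single-conjunct summit the two coincide, so the duplicate is deliberate.
set_option linter.dupNamespace false

noncomputable section

namespace Summit.AnomalousDissipation.AnomalousDissipation.Theorems.DenseLoudDesignerForces.Ergodic

open Set
open Literature.Analysis.FunctionSpaces Literature.Analysis.FunctionSpaces.Torus
open Literature.Analysis.FluidPDE Literature.Analysis.FluidPDE.Torus

/-- **Tools stub N0f — existence of the linearised flow along a classical trajectory.**  For `ν > 0`,
`a < b`, a velocity field `u` jointly smooth on `[a, b] × T³` with divergence-free slices (e.g. a classical
NS_ν(F) solution restricted to `[a, b]`), and a smooth divergence-free mean-zero datum `w₀`, the linearised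
Navier–Stokes system `∂ₜw + (u·∇)w + (w·∇)u = νΔw − ∇q`, `div w = 0`, `∫ w = 0` has a solution `(w, q)`
jointly smooth on `[a, b] × T³` with `w(a) = w₀` (Constantin–Foias 1988, Ch. 14, (14.3)–(14.4): the linearised
equation along `S(t)u₀` and its solution operator `S'(t; u₀)`; Temam 1997, Ch. VI (3.11): it "possesses a unique
solution" — uniqueness is the landed `Torus.linearisedNS_unique`).  Proof: the tree's
`Torus.linearisedNS_exists` (Fourier–Picard construction on the frequency lattice, `LinearisedNSFourier*`)
at `d = Fin 3`, repackaged into the line's predicate `IsLinearizedNSSolutionOn`.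
[cite: ConstantinFoiasNSE1988, Ch. 14 (14.3)] -/
theorem stub_linearisedExistenceTools {ν : ℝ} (hν : 0 < ν) {a b : ℝ} (hab : a < b)
    {u : ℝ → (UnitAddTorus (Fin 3)) → (EuclideanSpace ℝ (Fin 3))} (hu : IsSmoothSpaceTimeOn (Icc a b) u)
    (hudiv : ∀ t ∈ Icc a b, IsDivFree (u t))
    {w₀ : (UnitAddTorus (Fin 3)) → (EuclideanSpace ℝ (Fin 3))} (hw₀ : IsSmooth w₀) (hw₀div : IsDivFree w₀)
    (hw₀mean : HasZeroMean w₀) :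
    ∃ (w : ℝ → (UnitAddTorus (Fin 3)) → (EuclideanSpace ℝ (Fin 3))) (q : ℝ → (UnitAddTorus (Fin 3)) → ℝ),
      IsLinearizedNSSolutionOn (Icc a b) ν u w q ∧ w a = w₀ := by
  obtain ⟨w, q, hw, hq, hdiv, hmean, -, hmom, h0⟩ :=
    Torus.linearisedNS_exists hν hab hu hudiv hw₀ hw₀div hw₀mean
  exact ⟨w, q, ⟨hw, hq, hdiv, hmean, hmom⟩, h0⟩

end Summit.AnomalousDissipation.AnomalousDissipation.Theorems.DenseLoudDesignerForces.Ergodic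

end
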